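import Summits.CriticalPhenomena.CardyFormulaZ2.Theorems.CardyMeckeFlipMeckeRigidityDilationFlipFair
import Summits.CriticalPhenomena.CardyFormulaZ2.Theorems.CardyMeckeFlipMeckeRigidityDilationConjugation
import Summits.CriticalPhenomena.CardyFormulaZ2.Theorems.CardyMeckeFlipMeckeRigidityDilationSelfDual
import Summits.CriticalPhenomena.CardyFormulaZ2.Theorems.CardyMeckeFlipMeckeRigidityDilationRSW
import Summits.CriticalPhenomena.CardyFormulaZ2.Theorems.CardyMeckeFlipMeckeRigidityCampbellIntensity
import Summits.CriticalPhenomena.CardyFormulaZ2.Theorems.CardyMeckeFlipMeckeRigidityDichotomy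

/-!
# Similarity covariance of the axioms of `MeckeRigidity`: (EXT), (E2), equivariance, (ADM) transport under dilations; a model is equal or singular to its dilates; the uniqueness stub forces scale invariance

Route `Summits/CriticalPhenomena/CardyFormulaZ2/Theses/CardyMeckeFlip`, crux `MeckeRigidity`
(item stmt-CriticalPhenomena-14826), line `registered`, similarity-covariance package (lead c3),
registered sub-goals `isFlipExtremal_map_dilate`, `map_isometry_map_dilate`,
`isIsometryEquivariant_dilateKernel`, `isAdmissibleKernel_map_dilate`, `map_dilate_eq_or_mutuallySingular`,
`scaleInvariant_of_notMutuallySingular`.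

Write `S_t = QuadConfig.dilate t` (`t > 0`) for the dilation of configurations, `m_t w = t w`, and
`M^t ε S := (m_t)_* M (ε/t) (S_{t⁻¹} S)` for the RESCALED kernel family.  The companion files give the
dilation API (`…DilationAPI`), the conjugation of isometries by dilations (`…DilationConjugation`), the
covariance of the pivotal predicate (`…DilationPivotal`), the transport of (D) (`…DilationSelfDual`), of
(RSW) (`…DilationRSW`) and of (F) (`…DilationFlipFair`).  Here:

* **(EXT) transports** (`isFlipExtremal_map_dilate`): a midpoint decomposition of `(S_t)_* P` by laws
  flip-fair for every `M^t ε` pulls back under `S_{t⁻¹}` to one of `P` by laws flip-fair for every `M ε`,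
  because `(M^t)^{t⁻¹} = M` ON THE NOSE (`dilateKernel_inv`) and (F) transports at the factor `t⁻¹`.
* **(E2) transports** (`map_isometry_map_dilate`): dilations normalise the isometry group.
* **equivariance transports** (`isIsometryEquivariant_dilateKernel`): `M^t ε (g·S) = g_* M^t ε S`.
* **(ADM) transports** (`isAdmissibleKernel_map_dilate`): measurability (`Measure.measurable_map`),
  antitonicity, local integrability (closed balls pull back into closed balls), pivotal support
  (covariance of `IsPivotalAt`), and NON-DEGENERACY — the one place where (E2) and the kernel
  equivariance are used, through the landed Campbell intensity `∫ M ε₀ S (A) dP = c·Leb A`, `c > 0`.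
* **Equal or singular to its own dilates** (`map_dilate_eq_or_mutuallySingular_of`): by the transports,
  `((S_t)_* P, M^t)` is a second pair with (E2)+(ADM)+(F)+(EXT), so the landed dichotomy
  `eq_or_mutuallySingular` (both laws are translation ergodic) gives `(S_t)_* P = P ∨ (S_t)_* P ⟂ P`;
  the scale stabiliser `{t : (S_t)_* P = P}` is a subgroup of `(0,∞)` (`map_dilate_mul_eq_self`,
  `map_dilate_inv_eq_self`).
* **The uniqueness stub forces scale invariance** (`scaleInvariant_of_notMutuallySingular`): with (D) and
  (RSW) transported as well, a model of ALL six clauses of the crux and its dilate are two models; the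
  load-bearing stub `stub_notMutuallySingular` of the line (taken verbatim as a hypothesis) makes them
  non-singular, hence equal: under the stub EVERY model is scale-invariant — the stub contains, for
  flip-extremal laws, the scale-invariance crux of the sibling rigidity routes (ScaleInvariantLimits /
  CardyScaleErgodic), and any model with a scale refutes it with its own dilate as the second model.
-/

noncomputable section

open MeasureTheory Set Metric Filter Topology
open scoped ENNReal NNReal
open Literature.Probability.Percolation Literature.Probability.Percolation.QuadCrossing

namespace Summit.CriticalPhenomena.CardyFormulaZ2.Theorems.CardyMeckeFlip

/-! ## (EXT) transports under dilations -/

/-- `(m_{t⁻¹})_* (m_t)_* μ = μ` on `ℂ`. [folklore] -/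
theorem map_real_mul_inv_map_real_mul (t : ℝ) (ht : t ≠ 0) (μ : Measure ℂ) :
    Measure.map (fun w : ℂ => ((t⁻¹ : ℝ) : ℂ) * w) (Measure.map (fun w : ℂ => (t : ℂ) * w) μ) = μ := by
  rw [Measure.map_map (measurable_real_mul _) (measurable_real_mul t)]
  have : ((fun w : ℂ => ((t⁻¹ : ℝ) : ℂ) * w) ∘ fun w : ℂ => (t : ℂ) * w) = id := by
    funext w
    simp only [Function.comp_apply, id_eq, ← mul_assoc, Complex.ofReal_inv,
      inv_mul_cancel₀ (Complex.ofReal_ne_zero.mpr ht), one_mul]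
  rw [this, Measure.map_id]

/-- **`(M^t)^{t⁻¹} = M`**: rescaling the rescaled kernel family back by `t⁻¹` returns the original
family, on the nose. [folklore] -/
theorem dilateKernel_inv (M : ℝ → QuadConfig (univ : Set ℂ) → Measure ℂ) (t : ℝ) (ht : 0 < t) (ε : ℝ) :
    (fun S : QuadConfig (univ : Set ℂ) => Measure.map (fun w : ℂ => ((t⁻¹ : ℝ) : ℂ) * w)
      ((fun (ε' : ℝ) (S' : QuadConfig (univ : Set ℂ)) => Measure.map (fun w : ℂ => (t : ℂ) * w)
        (M (ε' / t) (QuadConfig.dilate t⁻¹ (inv_ne_zero ht.ne') S'))) (ε / t⁻¹)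
          (QuadConfig.dilate t⁻¹⁻¹ (inv_ne_zero (inv_ne_zero ht.ne')) S))) = M ε := by
  funext S
  simp only
  rw [map_real_mul_inv_map_real_mul t ht.ne', quadConfig_dilate_congr _ ht.ne' (inv_inv t) S,
    quadConfig_dilate_inv_dilate]
  congr 1
  field_simp

/-- Pulling a law back by `S_{t⁻¹}`: flip-fairness for every `M^t ε` becomes flip-fairness for every
`M ε`. [folklore] -/
theorem isFlipFairKernel_map_dilate_inv_of_dilateKernel {R : Measure (QuadConfig (univ : Set ℂ))}
    {M : ℝ → QuadConfig (univ : Set ℂ) → Measure ℂ} {t : ℝ} (ht : 0 < t)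
    (hR : ∀ ε : ℝ, 0 < ε → IsFlipFairKernel R (fun S => Measure.map (fun w : ℂ => (t : ℂ) * w)
      (M (ε / t) (QuadConfig.dilate t⁻¹ (inv_ne_zero ht.ne') S)))) :
    ∀ ε : ℝ, 0 < ε →
      IsFlipFairKernel (Measure.map (QuadConfig.dilate t⁻¹ (inv_pos.mpr ht).ne') R) (M ε) := by
  intro ε hε
  have h := isFlipFairKernel_map_dilate R (fun (ε' : ℝ) (S' : QuadConfig (univ : Set ℂ)) =>
    Measure.map (fun w : ℂ => (t : ℂ) * w) (M (ε' / t) (QuadConfig.dilate t⁻¹ (inv_ne_zero ht.ne') S')))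
    t⁻¹ (inv_pos.mpr ht) ε (hR (ε / t⁻¹) (div_pos hε (inv_pos.mpr ht)))
  rwa [dilateKernel_inv M t ht ε] at h

/-- **(EXT) transports under dilations** (registered sub-goal `isFlipExtremal_map_dilate` of item
stmt-CriticalPhenomena-14826). [folklore] -/
theorem isFlipExtremal_map_dilate : ∀ (P : Measure (QuadConfig (Set.univ : Set ℂ))) (M : ℝ → QuadConfig (Set.univ : Set ℂ) → Measure ℂ) (t : ℝ) (ht : 0 < t), IsFlipExtremal P M → IsFlipExtremal (Measure.map (QuadConfig.dilate t ht.ne') P) (fun ε S => Measure.map (fun w : ℂ => (t : ℂ) * w) (M (ε / t) (QuadConfig.dilate t⁻¹ (inv_ne_zero ht.ne') S))) := by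
  intro P M t ht hEXT P₁ P₂ hP₁ hP₂ hF₁ hF₂ hsum
  have ht' : (t⁻¹ : ℝ) ≠ 0 := (inv_pos.mpr ht).ne'
  -- pull the decomposition back by `S_{t⁻¹}`
  haveI : IsProbabilityMeasure (Measure.map (QuadConfig.dilate t⁻¹ ht') P₁) :=
    isProbabilityMeasure_map_dilate P₁ t⁻¹ ht'
  haveI : IsProbabilityMeasure (Measure.map (QuadConfig.dilate t⁻¹ ht') P₂) :=
    isProbabilityMeasure_map_dilate P₂ t⁻¹ ht'
  have hF₁' := isFlipFairKernel_map_dilate_inv_of_dilateKernel ht hF₁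
  have hF₂' := isFlipFairKernel_map_dilate_inv_of_dilateKernel ht hF₂
  have hsum' : Measure.map (QuadConfig.dilate t⁻¹ ht') P₁ + Measure.map (QuadConfig.dilate t⁻¹ ht') P₂ =
      P + P := by
    rw [← Measure.map_add _ _ (measurable_quadConfig_dilate _ _), hsum,
      Measure.map_add _ _ (measurable_quadConfig_dilate _ _), map_dilate_inv_map_dilate P t ht.ne']
  have h₁ : Measure.map (QuadConfig.dilate t⁻¹ ht') P₁ = P := hEXT _ _ inferInstance inferInstance hF₁' hF₂' hsum'
  -- push forward again
  calc P₁ = Measure.map (QuadConfig.dilate t ht.ne') (Measure.map (QuadConfig.dilate t⁻¹ ht') P₁) :=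
        (map_dilate_map_dilate_inv P₁ t ht.ne').symm
    _ = Measure.map (QuadConfig.dilate t ht.ne') P := by rw [h₁]

/-! ## (E2) transports under dilations -/

/-- **(E2) transports under dilations** (registered sub-goal `map_isometry_map_dilate` of item
stmt-CriticalPhenomena-14826): the dilated law `(S_t)_* P` is invariant under every plane isometry when
`P` is. [folklore] -/
theorem map_isometry_map_dilate : ∀ (P : Measure (QuadConfig (Set.univ : Set ℂ))) (t : ℝ) (ht : 0 < t), (∀ g : ℂ ≃ᵢ ℂ, Measure.map (QuadConfig.isometry g) P = P) → ∀ g : ℂ ≃ᵢ ℂ, Measure.map (QuadConfig.isometry g) (Measure.map (QuadConfig.dilate t ht.ne') P) = Measure.map (QuadConfig.dilate t ht.ne') P := by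
  intro P t ht hE2 g
  obtain ⟨g', -, hcomm, -⟩ := exists_isometry_dilate_comm t ht g
  have hg : Measurable (QuadConfig.isometry g) := (continuous_quadConfig_isometry g).measurable
  have hg' : Measurable (QuadConfig.isometry g') := (continuous_quadConfig_isometry g').measurable
  have hD : Measurable (QuadConfig.dilate t ht.ne') := measurable_quadConfig_dilate t ht.ne'
  rw [Measure.map_map hg hD]
  have hfun : (QuadConfig.isometry g ∘ QuadConfig.dilate t ht.ne' : QuadConfig (univ : Set ℂ) → QuadConfig univ)
      = QuadConfig.dilate t ht.ne' ∘ QuadConfig.isometry g' :=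
    funext fun S => (hcomm S).symm
  rw [hfun, ← Measure.map_map hD hg', hE2 g']

/-! ## Kernel equivariance transports -/

/-- **Isometry-equivariance of the rescaled kernel family** (registered sub-goal
`isIsometryEquivariant_dilateKernel` of item stmt-CriticalPhenomena-14826). [folklore] -/
theorem isIsometryEquivariant_dilateKernel : ∀ (M : ℝ → QuadConfig (Set.univ : Set ℂ) → Measure ℂ) (t : ℝ) (ht : 0 < t), IsIsometryEquivariant M → IsIsometryEquivariant (fun ε S => Measure.map (fun w : ℂ => (t : ℂ) * w) (M (ε / t) (QuadConfig.dilate t⁻¹ (inv_ne_zero ht.ne') S))) := by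
  intro M t ht hEq g ε S
  obtain ⟨g', hg'w, -, hcomm⟩ := exists_isometry_dilate_comm t ht g
  have ht0 : (t : ℂ) ≠ 0 := Complex.ofReal_ne_zero.mpr ht.ne'
  simp only
  rw [← hcomm S, hEq g' (ε / t), Measure.map_map (measurable_real_mul t) g'.continuous.measurable,
    Measure.map_map g.continuous.measurable (measurable_real_mul t)]
  congr 1
  funext w
  simp only [Function.comp_apply, hg'w, ← mul_assoc, mul_inv_cancel₀ ht0, one_mul]

/-! ## (ADM) transports -/

/-- The pull-back of a closed ball under `m_t` lies in the closed ball of radius `r / t`. [folklore] -/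
theorem preimage_real_mul_closedBall_subset (t : ℝ) (ht : 0 < t) (r : ℝ) :
    (fun w : ℂ => (t : ℂ) * w) ⁻¹' closedBall (0 : ℂ) r ⊆ closedBall 0 (r / t) := by
  intro w hw
  simp only [mem_preimage, mem_closedBall, dist_zero_right, norm_mul, Complex.norm_real,
    Real.norm_eq_abs, abs_of_pos ht] at hw ⊢
  rw [le_div_iff₀ ht, mul_comm]
  exact hw

/-- The non-pivotal set of a dilated configuration pulls back under `m_t` to the non-pivotal set of the
configuration. [folklore] -/
theorem preimage_real_mul_setOf_not_isPivotalAt (t : ℝ) (ht : 0 < t) (S : QuadConfig (univ : Set ℂ)) :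
    (fun w : ℂ => (t : ℂ) * w) ⁻¹' {x | ¬ ∃ Q : Quad (univ : Set ℂ), (QuadConfig.dilate t ht.ne' S).IsPivotalAt x Q} =
      {x | ¬ ∃ Q : Quad (univ : Set ℂ), S.IsPivotalAt x Q} := by
  ext y
  simp only [mem_preimage, mem_setOf_eq, not_iff_not]
  constructor
  · rintro ⟨Q, hQ⟩
    exact ⟨_, (isPivotalAt_dilate_mul_iff t ht S y Q).1 hQ⟩
  · rintro ⟨Q, hQ⟩
    refine ⟨Q.dilate t ht.ne', ?_⟩
    rw [isPivotalAt_dilate_mul_iff t ht, quad_dilate_inv_dilate]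
    exact hQ

/-- **(ADM) transports under dilations** (registered sub-goal `isAdmissibleKernel_map_dilate` of item
stmt-CriticalPhenomena-14826): the rescaled kernel family `M^t` is admissible for `(S_t)_* P`; the
non-degeneracy clause uses (E2) and the kernel equivariance through the Campbell intensity. [folklore] -/
theorem isAdmissibleKernel_map_dilate : ∀ (P : Measure (QuadConfig (Set.univ : Set ℂ))) (M : ℝ → QuadConfig (Set.univ : Set ℂ) → Measure ℂ) (t : ℝ) (ht : 0 < t), IsProbabilityMeasure P → (∀ g : ℂ ≃ᵢ ℂ, Measure.map (QuadConfig.isometry g) P = P) → IsAdmissibleKernel P M → IsIsometryEquivariant M → IsAdmissibleKernel (Measure.map (QuadConfig.dilate t ht.ne') P) (fun ε S => Measure.map (fun w : ℂ => (t : ℂ) * w) (M (ε / t) (QuadConfig.dilate t⁻¹ (inv_ne_zero ht.ne') S))) := by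
  intro P M t ht hP hE2 hADM hEq
  have hD := measurableEmbedding_quadConfig_dilate t ht.ne'
  have hm := measurableEmbedding_real_mul t ht.ne'
  have hmm : Measurable (fun w : ℂ => (t : ℂ) * w) := measurable_real_mul t
  refine ⟨?_, ?_, ?_, ?_, ?_⟩
  · -- (1) measurability
    intro ε
    exact (Measure.measurable_map _ hmm).comp
      ((hADM.measurable (ε / t)).comp (measurable_quadConfig_dilate _ _))
  · -- (2) antitone in the cutoff
    intro ε ε' hε' hle S
    exact Measure.map_mono (hADM.antitone (ε / t) (ε' / t) (div_pos hε' ht)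
      (div_le_div_of_nonneg_right hle ht.le) _) hmm
  · -- (3) local integrability
    intro ε hε r
    rw [hD.lintegral_map]
    simp only [quadConfig_dilate_inv_dilate]
    calc ∫⁻ S, Measure.map (fun w : ℂ => (t : ℂ) * w) (M (ε / t) S) (closedBall 0 r) ∂P
        = ∫⁻ S, M (ε / t) S ((fun w : ℂ => (t : ℂ) * w) ⁻¹' closedBall 0 r) ∂P := by
          simp_rw [hm.map_apply]
      _ ≤ ∫⁻ S, M (ε / t) S (closedBall 0 (r / t)) ∂P :=
          lintegral_mono fun S => measure_mono (preimage_real_mul_closedBall_subset t ht r)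
      _ < ⊤ := hADM.lintegral_closedBall_lt_top (ε / t) (div_pos hε ht) (r / t)
  · -- (4) supported on pivotal points
    intro ε hε
    rw [hD.ae_map_iff]
    filter_upwards [hADM.ae_apply_not_isPivotalAt (ε / t) (div_pos hε ht)] with S hS
    simp only [quadConfig_dilate_inv_dilate]
    rw [hm.map_apply, preimage_real_mul_setOf_not_isPivotalAt t ht S]
    exact hS
  · -- (5) non-degenerate: the Campbell intensity is `c · Leb`, `c > 0`, at the cutoff `ε₀` of `P`
    haveI := hP
    obtain ⟨ε₀, hε₀, c, hc, hint⟩ := exists_campbellIntensity_pos P M hE2 hADM hEq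
    refine ⟨t * ε₀, mul_pos ht hε₀, ?_⟩
    rw [hD.lintegral_map]
    simp only [quadConfig_dilate_inv_dilate]
    simp_rw [hm.map_apply]
    rw [mul_div_cancel_left₀ ε₀ ht.ne', hint _ (hmm measurableSet_ball)]
    have hopen : IsOpen ((fun w : ℂ => (t : ℂ) * w) ⁻¹' ball (0 : ℂ) 1) :=
      (continuous_const.mul continuous_id).isOpen_preimage _ isOpen_ball
    have hpos : 0 < volume ((fun w : ℂ => (t : ℂ) * w) ⁻¹' ball (0 : ℂ) 1) :=
      hopen.measure_pos volume ⟨0, by simp⟩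
    exact ENNReal.mul_pos (by exact_mod_cast hc.ne') hpos.ne'

/-! ## Equal or singular to its own dilates; the scale stabiliser is a subgroup -/

/-- **Equal or singular to its own dilates.**  A probability law on `ℋ_ℂ` with (E2), an admissible
isometry-equivariant kernel family that is flip-fair at every cutoff, and (EXT), is for every `t > 0` either
invariant under the dilation `S_t` or mutually singular to its `S_t`-image. [folklore] -/
theorem map_dilate_eq_or_mutuallySingular_of {P : Measure (QuadConfig (univ : Set ℂ))} [IsProbabilityMeasure P]
    {M : ℝ → QuadConfig (univ : Set ℂ) → Measure ℂ}
    (hE2 : ∀ g : ℂ ≃ᵢ ℂ, Measure.map (QuadConfig.isometry g) P = P)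
    (hADM : IsAdmissibleKernel P M) (hEq : IsIsometryEquivariant M)
    (hF : ∀ ε : ℝ, 0 < ε → IsFlipFairKernel P (M ε)) (hEXT : IsFlipExtremal P M)
    (t : ℝ) (ht : 0 < t) :
    Measure.map (QuadConfig.dilate t ht.ne') P = P ∨ Measure.map (QuadConfig.dilate t ht.ne') P ⟂ₘ P := by
  haveI : IsProbabilityMeasure (Measure.map (QuadConfig.dilate t ht.ne') P) :=
    isProbabilityMeasure_map_dilate P t ht.ne'
  exact eq_or_mutuallySingular (map_isometry_map_dilate P t ht hE2) hE2
    (isAdmissibleKernel_map_dilate P M t ht inferInstance hE2 hADM hEq) hADM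
    (fun ε hε => isFlipFairKernel_map_dilate P M t ht ε (hF (ε / t) (div_pos hε ht))) hF
    (isFlipExtremal_map_dilate P M t ht hEXT) hEXT

/-- **Registered form** (sub-goal `map_dilate_eq_or_mutuallySingular` of item stmt-CriticalPhenomena-14826).
[folklore] -/
theorem map_dilate_eq_or_mutuallySingular : ∀ (P : Measure (QuadConfig (Set.univ : Set ℂ))) (M : ℝ → QuadConfig (Set.univ : Set ℂ) → Measure ℂ) (t : ℝ) (ht : 0 < t), IsProbabilityMeasure P → (∀ g : ℂ ≃ᵢ ℂ, Measure.map (QuadConfig.isometry g) P = P) → IsAdmissibleKernel P M → IsIsometryEquivariant M → (∀ ε : ℝ, 0 < ε → IsFlipFairKernel P (M ε)) → IsFlipExtremal P M → Measure.map (QuadConfig.dilate t ht.ne') P = P ∨ Measure.map (QuadConfig.dilate t ht.ne') P ⟂ₘ P := by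
  intro P M t ht hP hE2 hADM hEq hF hEXT
  exact map_dilate_eq_or_mutuallySingular_of hE2 hADM hEq hF hEXT t ht

/-- **Scale-invariance is closed under products**: if `P` is `S_s`- and `S_t`-invariant then it is
`S_{st}`-invariant. [folklore] -/
theorem map_dilate_mul_eq_self {P : Measure (QuadConfig (univ : Set ℂ))} {s t : ℝ} (hs : s ≠ 0) (ht : t ≠ 0)
    (hPs : Measure.map (QuadConfig.dilate s hs) P = P) (hPt : Measure.map (QuadConfig.dilate t ht) P = P) :
    Measure.map (QuadConfig.dilate (s * t) (mul_ne_zero hs ht)) P = P := by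
  have hfun : (QuadConfig.dilate (s * t) (mul_ne_zero hs ht) : QuadConfig (univ : Set ℂ) → QuadConfig univ) =
      QuadConfig.dilate s hs ∘ QuadConfig.dilate t ht :=
    funext fun S => (quadConfig_dilate_dilate s t hs ht S).symm
  rw [hfun, ← Measure.map_map (measurable_quadConfig_dilate s hs) (measurable_quadConfig_dilate t ht), hPt, hPs]

/-- **Scale-invariance is closed under inverses**: if `P` is `S_t`-invariant then it is `S_{t⁻¹}`-invariant.
[folklore] -/
theorem map_dilate_inv_eq_self {P : Measure (QuadConfig (univ : Set ℂ))} {t : ℝ} (ht : t ≠ 0)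
    (hPt : Measure.map (QuadConfig.dilate t ht) P = P) :
    Measure.map (QuadConfig.dilate t⁻¹ (inv_ne_zero ht)) P = P := by
  conv_lhs => rw [← hPt]
  exact map_dilate_inv_map_dilate P t ht

/-! ## The uniqueness stub forces scale invariance -/

/-- **`stub_notMutuallySingular` ⟹ scale invariance of every model** (registered sub-goal
`scaleInvariant_of_notMutuallySingular` of item stmt-CriticalPhenomena-14826; the first hypothesis is the
load-bearing stub of line `registered`, verbatim). [folklore] -/
theorem scaleInvariant_of_notMutuallySingular : (∀ (P P' : Measure (QuadConfig (Set.univ : Set ℂ))) (M M' : ℝ → QuadConfig (Set.univ : Set ℂ) → Measure ℂ), IsProbabilityMeasure P → IsProbabilityMeasure P' → (∀ g : ℂ ≃ᵢ ℂ, Measure.map (QuadConfig.isometry g) P = P) → (∀ g : ℂ ≃ᵢ ℂ, Measure.map (QuadConfig.isometry g) P' = P') → (∀ (n : ℕ) (Q Qt : Fin n → Quad (Set.univ : Set ℂ)), (∀ i, (Qt i).carrier = (Q i).carrier ∧ (Qt i).side 0 = (Q i).side 1 ∧ (Qt i).side 1 = (Q i).side 2 ∧ (Qt i).side 2 = (Q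 i).side 3 ∧ (Qt i).side 3 = (Q i).side 0) → ∀ A : Set (Set (Fin n)), P {S | {i | Q i ∈ S} ∈ A} = P {S | {i | Qt i ∉ S} ∈ A}) → (∀ (n : ℕ) (Q Qt : Fin n → Quad (Set.univ : Set ℂ)), (∀ i, (Qt i).carrier = (Q i).carrier ∧ (Qt i).side 0 = (Q i).side 1 ∧ (Qt i).side 1 = (Q i).side 2 ∧ (Qt i).side 2 = (Q i).side 3 ∧ (Qt i).side 3 = (Q i).side 0) → ∀ A : Set (Set (Fin n)), P' {S | {i | Q i ∈ S} ∈ A} = P' {S | {i | Qt i ∉ S} ∈ A}) → (∃ c : ℝ, 0 < c ∧ ∀ (a x y : ℝ), 0 < a → ∀ Q : Quad (Set.univ : Set ℂ), Q.carrier = {w : ℂ | x ≤ w.re ∧ w.re ≤ x + 3 * a ∧ y ≤ w.im ∧ w.im ≤ y + a} → Q.side 0 = {w : ℂ | w.re = x ∧ y ≤ w.im ∧ w.im ≤ y + a} → Q.side 2 = {w : ℂ | w.re = x + 3 * a ∧ y ≤ w.im ∧ w.im ≤ y + a} → c ≤ P.real (QuadConfig.crossedEvent Q)) → (∃ c : ℝ,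 0 < c ∧ ∀ (a x y : ℝ), 0 < a → ∀ Q : Quad (Set.univ : Set ℂ), Q.carrier = {w : ℂ | x ≤ w.re ∧ w.re ≤ x + 3 * a ∧ y ≤ w.im ∧ w.im ≤ y + a} → Q.side 0 = {w : ℂ | w.re = x ∧ y ≤ w.im ∧ w.im ≤ y + a} → Q.side 2 = {w : ℂ | w.re = x + 3 * a ∧ y ≤ w.im ∧ w.im ≤ y + a} → c ≤ P'.real (QuadConfig.crossedEvent Q)) → IsAdmissibleKernel P M → IsIsometryEquivariant M → (∀ ε : ℝ, 0 < ε → IsFlipFairKernel P (M ε)) → IsFlipExtremal P M → IsAdmissibleKernel P' M' → IsIsometryEquivariant M' → (∀ ε : ℝ, 0 < ε → IsFlipFairKernel P' (M' ε)) → IsFlipExtremal P' M' → ¬ P ⟂ₘ P') → ∀ (P : Measure (QuadConfig (Set.univ : Set ℂ))) (M : ℝ → QuadConfig (Set.univ : Set ℂ) → Measure ℂ) (t : ℝ) (ht : 0 < t), IsProbabilityMeasure P → (∀ g : ℂ ≃ᵢ ℂ, Measure.map (QuadConfig.isometry g) P = P) → (∀ (n : ℕ) (Q Qt : Fin n → Quad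 (Set.univ : Set ℂ)), (∀ i, (Qt i).carrier = (Q i).carrier ∧ (Qt i).side 0 = (Q i).side 1 ∧ (Qt i).side 1 = (Q i).side 2 ∧ (Qt i).side 2 = (Q i).side 3 ∧ (Qt i).side 3 = (Q i).side 0) → ∀ A : Set (Set (Fin n)), P {S | {i | Q i ∈ S} ∈ A} = P {S | {i | Qt i ∉ S} ∈ A}) → (∃ c : ℝ, 0 < c ∧ ∀ (a x y : ℝ), 0 < a → ∀ Q : Quad (Set.univ : Set ℂ), Q.carrier = {w : ℂ | x ≤ w.re ∧ w.re ≤ x + 3 * a ∧ y ≤ w.im ∧ w.im ≤ y + a} → Q.side 0 = {w : ℂ | w.re = x ∧ y ≤ w.im ∧ w.im ≤ y + a} → Q.side 2 = {w : ℂ | w.re = x + 3 * a ∧ y ≤ w.im ∧ w.im ≤ y + a} → c ≤ P.real (QuadConfig.crossedEvent Q)) → IsAdmissibleKernel P M → IsIsometryEquivariant M → (∀ ε : ℝ, 0 < ε → IsFlipFairKernel P (M ε)) → IsFlipExtremal P M → Measure.map (QuadConfig.dilate t ht.ne') P = P := by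
  intro hU P M t ht hP hE2 hD hRSW hADM hEq hF hEXT
  haveI : IsProbabilityMeasure (Measure.map (QuadConfig.dilate t ht.ne') P) :=
    isProbabilityMeasure_map_dilate P t ht.ne'
  -- the dilate is a second model
  have hE2' := map_isometry_map_dilate P t ht hE2
  have hD' := selfDual_map_dilate P t ht hD
  have hRSW' := rsw_map_dilate P t ht hRSW
  have hADM' := isAdmissibleKernel_map_dilate P M t ht inferInstance hE2 hADM hEq
  have hEq' := isIsometryEquivariant_dilateKernel M t ht hEq
  have hF' : ∀ ε : ℝ, 0 < ε → IsFlipFairKernel (Measure.map (QuadConfig.dilate t ht.ne') P)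
      ((fun (ε : ℝ) (S : QuadConfig (univ : Set ℂ)) => Measure.map (fun w : ℂ => (t : ℂ) * w)
        (M (ε / t) (QuadConfig.dilate t⁻¹ (inv_ne_zero ht.ne') S))) ε) :=
    fun ε hε => isFlipFairKernel_map_dilate P M t ht ε (hF (ε / t) (div_pos hε ht))
  have hEXT' := isFlipExtremal_map_dilate P M t ht hEXT
  -- non-singular by the stub, hence equal by the dichotomy
  have hns := hU _ P _ M inferInstance hP hE2' hE2 hD' hD hRSW' hRSW hADM' hEq' hF' hEXT' hADM hEq hF hEXT
  rcases map_dilate_eq_or_mutuallySingular_of hE2 hADM hEq hF hEXT t ht with h | h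
  · exact h
  · exact (hns h).elim

end Summit.CriticalPhenomena.CardyFormulaZ2.Theorems.CardyMeckeFlip

end
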